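import Summits.AtomisticToContinuum.FouriersLaw.Theses.StaticAbelianSqueeze
import Summits.AtomisticToContinuum.FouriersLaw.Theses.EmbeddedDrudeMourre
import Summits.AtomisticToContinuum.FouriersLaw.Theorems.StaticAbelianSqueezeUniformAbelianRegularityRieszWindow
import Summits.AtomisticToContinuum.FouriersLaw.Theorems.EmbeddedDrudeMourreAbelThermodynamicLimitKaramataRieszTwo
import Summits.AtomisticToContinuum.FouriersLaw.Theorems.StaticAbelianSqueezeUniformAbelianRegularityMonotoneWindow
import Summits.AtomisticToContinuum.FouriersLaw.Theorems.LatticeLandauDampingAbelThermodynamicLimitAutocorrIntegrableOn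
import HarnessLib

/-!
# (R) from an Abel-summable light-cone splice and post-crossing tails — certificate of line `Sketch`, rev 4
(crux `StaticAbelianSqueeze.UniformAbelianRegularity` = (R), item stmt-AtomisticToContinuum-13416; `--supports` file proving the registered
glue stub `stub_regularityOfAbelSummableSpliceAndTails`; closes nothing)

WHAT.  Two sorry-free reductions of the crux (R) — "for every `ε > 0` there is `ν₀ > 0` such that for all `ν ∈ (0, ν₀)`, eventually in
`N`, `|∫₀^∞ (1 − e^{−νt}) c_N(t) dt| ≤ ε N`" for the equilibrium total-current autocorrelation `c_N` of the open pinned chain — to two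
physical statements:
* a LIGHT-CONE SPLICE up to the linear horizon, `∫_{(0,c₀N]} |c_N − (N−1) C − E| ≤ K`, in which the bulk function `C` enters ONLY
  through `|C| ≤ M` and the convergence of its order-2 Riesz means `∫₀^τ (1 − t/τ)² C → Λ` and Abel means `∫₀^∞ e^{−νt} C → Λ` to a
  common finite value (`uniformAbelianRegularity_of_rieszSummableSplice_and_tails`), resp. through `|C| ≤ M`, positive type in
  doubly-integrated form and convergent Abel means (`stub_regularityOfAbelSummableSpliceAndTails`, the Riesz half being the landed
  Karamata lemma `LoomisCompactHorizonWitness.stub_karamataRieszTwo`, p87844), and the end correction `E` is `N`-free, locally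
  integrable and Cesàro-small;
* POST-CROSSING SIGNED TAILS `|∫_{(ξ,∞)} c_N| ≤ ε N` for `ξ ≥ c₀ N` (the registered stub `stub_postCrossingTails` of the line).
Compared with the rev-3 certificate `ZeroMeanDyadicSplice.stub_regularityOfSpliceAndTails` (p152607) the spectral conjunct K4 of the
splice ("the bulk current spectral measure has a density continuous at `0` on a window") is GONE.

HOW.  Cut `1 − e^{−νt} = W + L` at the linear horizon `τ = c₀N` with `W(t) = χ(t/τ)(1 − e^{−νt})`, `χ` the three-kernel Riesz window
(`…RieszWindow`).  EARLY: the splice turns `∫ W c_N` into `(N−1) ∫ W C + ∫ W E + ∫ W R` with `|∫ W E| ≤ ∫₀^{c₀N} |E| ≤ εN/8`,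
`|∫ W R| ≤ K ≤ εN/8`, and `|∫ W C| ≤ ε/8` by the early bulk window lemma (`early_bulk_window`).  LATE: `L` is continuous, monotone,
`0` on `[0, c₀N/2]`, `≤ 1`, so Bonnet's bound (`ZeroMeanDyadicSplice.stub_monotoneWindow`, p149168) and the tails at slope `c₀/2` give
`|∫ L c_N| ≤ εN/8`.  Fixed-`N` integrability of `c_N` is `SeriesLawAtEveryLaplaceFrequency.stub_autocorrIntegrableOn` (p144688).

Provenance: written sorry-free by planner-cstrat-stmt-AtomisticToContinuum-12596-s2-0 (`Cruxes/AbelThermodynamicLimit/Lines/abel_summable_splice.lean`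
@f427cf72cf92, attached to stmt-13416 13:07Z); landed (namespace/header adapted; the glue concludes the `EmbeddedDrudeMourre` copy, `rfl`-equal
to the `StaticAbelianSqueeze` one, cf. the landed `ZeroMeanDyadicSplice.uniformAbelianRegularity_edm_eq_sas`) by the line lead of stmt-13416 (c1), whose skeleton
`Cruxes/UniformAbelianRegularity/Lines/Sketch.lean` rev 4 composes the crux BY NAME from `stub_abelSummableSplice ∧ stub_postCrossingTails`.
References: Bonetto–Lebowitz–Rey-Bellet 2000 §7; Kundu–Dhar–Narayan 2009.  No named fact is used; nothing here closes the item.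
-/

noncomputable section

namespace Summit.AtomisticToContinuum.FouriersLaw.Theorems.UniformAbelianRegularity.AbelSummableSplice

open MeasureTheory Set Filter Topology

/-! ## The certificate: (R) from a Riesz/Abel-summable splice and post-crossing tails -/

/-- **(R) ⇐ (Riesz ∧ Abel)-summable splice ∧ post-crossing signed tails** (sorry-free; the three-kernel Riesz window at the linear
horizon `c₀N`).  The splice hypothesis carries the bulk only through `|C| ≤ M`, `∫₀^τ (1−t/τ)² C → Λ` and `∫₀^∞ e^{−νt} C → Λ`. [folklore] -/
theorem uniformAbelianRegularity_of_rieszSummableSplice_and_tails :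
    (∀ ω₂ lam β γ : ℝ, 0 < ω₂ → 0 < lam → 0 < β → 0 < γ → ∀ T : ℝ, 0 < T →
      ∃ (C E : ℝ → ℝ) (M Λ c₀ K : ℝ) (N₁ : ℕ),
        0 < c₀ ∧ 0 ≤ K ∧ Measurable C ∧ Measurable E ∧ (∀ t : ℝ, |C t| ≤ M) ∧
        Filter.Tendsto (fun τ : ℝ => ∫ t in Set.Ioc (0:ℝ) τ, (1 - t / τ) ^ 2 * C t) Filter.atTop (nhds Λ) ∧
        Filter.Tendsto (fun ν : ℝ => ∫ t in Set.Ioi (0:ℝ), Real.exp (-(ν * t)) * C t) (nhdsWithin (0:ℝ) (Set.Ioi 0)) (nhds Λ) ∧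
        (∀ τ : ℝ, 0 < τ → MeasureTheory.IntegrableOn E (Set.Ioc 0 τ)) ∧
        (∀ ε : ℝ, 0 < ε → ∃ τ₀ : ℝ, 0 < τ₀ ∧ ∀ τ : ℝ, τ₀ ≤ τ → ∫ t in Set.Ioc 0 τ, |E t| ≤ ε * τ) ∧
        (∀ N : ℕ, N₁ ≤ N → let J : Literature.MathematicalPhysics.KineticTheory.HeatConduction.PhaseSpace N → ℝ := fun z => ∑ i : Fin N, (Literature.MathematicalPhysics.KineticTheory.HeatConduction.pinnedChain ω₂ lam β γ).bondCurrent N i z; ∫ t in Set.Ioc 0 (c₀ * N), |(∫ z, J z * (∫ y, J y ∂((Literature.MathematicalPhysics.KineticTheory.HeatConduction.pinnedChain ω₂ lam β γ).transitionKernel N T T t.toNNReal z)) ∂((Literature.MathematicalPhysics.KineticTheory.HeatConduction.pinnedChain ω₂ lam β γ).gibbsMeasure N T)) - ((N:ℝ) - 1) * C t - E t| ≤ K)) →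
    (∀ ω₂ lam β γ : ℝ, 0 < ω₂ → 0 < lam → 0 < β → 0 < γ → ∀ T : ℝ, 0 < T → ∀ c₀ : ℝ, 0 < c₀ → ∀ ε : ℝ, 0 < ε →
      ∃ N₀ : ℕ, ∀ N : ℕ, N₀ ≤ N → ∀ ξ : ℝ, c₀ * N ≤ ξ → let J : Literature.MathematicalPhysics.KineticTheory.HeatConduction.PhaseSpace N → ℝ := fun z => ∑ i : Fin N, (Literature.MathematicalPhysics.KineticTheory.HeatConduction.pinnedChain ω₂ lam β γ).bondCurrent N i z; |∫ s in Set.Ioi ξ, ∫ z, J z * (∫ y, J y ∂((Literature.MathematicalPhysics.KineticTheory.HeatConduction.pinnedChain ω₂ lam β γ).transitionKernel N T T s.toNNReal z)) ∂((Literature.MathematicalPhysics.KineticTheory.HeatConduction.pinnedChain ω₂ lam β γ).gibbsMeasure N T)| ≤ ε * N) →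
    _root_.Summit.AtomisticToContinuum.FouriersLaw.Theses.StaticAbelianSqueeze.UniformAbelianRegularity := by
  intro h1 h3 ω₂ lam β γ hω hl hβ hγ T hT ε hε
  obtain ⟨C, E, M, Λ, c₀, K, N₁, hc₀, hK, hCm, hEm, hM, hRz, hAb, hEint, hCes, hmatch⟩ := h1 ω₂ lam β γ hω hl hβ hγ T hT
  have hε8 : 0 < ε / 8 := by positivity
  -- the three-kernel Riesz window
  set χ : ℝ → ℝ := fun s => 2 * (max (1 - 2 * s) 0) ^ 2 - 9 * (max (1 - 4 * s / 3) 0) ^ 2 + 8 * (max (1 - s) 0) ^ 2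
    with hχ_def
  have hχ : ∀ s, χ s = 2 * (max (1 - 2 * s) 0) ^ 2 - 9 * (max (1 - 4 * s / 3) 0) ^ 2 + 8 * (max (1 - s) 0) ^ 2 :=
    fun s => rfl
  have hχI : ∀ s, χ s ∈ Icc (0:ℝ) 1 := window_mem_Icc χ hχ
  have hχanti : Antitone χ := window_antitone χ hχ
  have hχcont : Continuous χ := (window_continuous_antitone χ hχ).1
  have hχ_one : ∀ s : ℝ, s ≤ 1 / 2 → χ s = 1 := fun s hs => window_eq_one χ hχ hs
  have hχ_zero : ∀ s : ℝ, 1 ≤ s → χ s = 0 := fun s hs => window_eq_zero χ hχ hs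
  -- early bulk window lemma: `ν₁`
  obtain ⟨ν₁, hν₁, hEB⟩ := early_bulk_window χ hχ C M Λ hCm hM hRz hAb (ε / 8) hε8
  obtain ⟨τ₀, hτ₀, hCes'⟩ := hCes (ε / (8 * c₀)) (by positivity)
  refine ⟨min ν₁ 1, lt_min hν₁ one_pos, fun ν hν hνlt => ?_⟩
  have hνν₁ : ν ≤ ν₁ := (hνlt.trans_le (min_le_left _ _)).le
  obtain ⟨τ₁, hτ₁, hC_bd'⟩ := hEB ν hν hνν₁
  obtain ⟨N₃, hN₃⟩ := h3 ω₂ lam β γ hω hl hβ hγ T hT (c₀ / 2) (by positivity) (ε / 8) hε8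
  refine ⟨max (max N₁ N₃) (⌈max τ₀ τ₁ / c₀⌉₊ + ⌈8 * K / ε⌉₊ + 1), fun N hN => ?_⟩
  have hN₁N : N₁ ≤ N := le_trans (le_trans (le_max_left _ _) (le_max_left _ _)) hN
  have hN₃N : N₃ ≤ N := le_trans (le_trans (le_max_right _ _) (le_max_left _ _)) hN
  have hbig : ⌈max τ₀ τ₁ / c₀⌉₊ + ⌈8 * K / ε⌉₊ + 1 ≤ N := le_trans (le_max_right _ _) hN
  have hN1 : 1 ≤ N := by omega
  have hNr1 : (1:ℝ) ≤ N := by exact_mod_cast hN1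
  have hNr0 : (0:ℝ) ≤ N := Nat.cast_nonneg N
  have hτN : max τ₀ τ₁ ≤ c₀ * N := by
    have h1' : max τ₀ τ₁ / c₀ ≤ ⌈max τ₀ τ₁ / c₀⌉₊ := Nat.le_ceil _
    have h2' : (⌈max τ₀ τ₁ / c₀⌉₊ : ℝ) ≤ N := by exact_mod_cast (by omega : ⌈max τ₀ τ₁ / c₀⌉₊ ≤ N)
    have h3' := (div_le_iff₀ hc₀).1 (h1'.trans h2')
    linarith [mul_comm (N:ℝ) c₀]
  have hKN : K ≤ ε / 8 * N := by
    have h1' : 8 * K / ε ≤ ⌈8 * K / ε⌉₊ := Nat.le_ceil _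
    have h2' : (⌈8 * K / ε⌉₊ : ℝ) ≤ N := by exact_mod_cast (by omega : ⌈8 * K / ε⌉₊ ≤ N)
    have h3' := (div_le_iff₀ hε).1 (h1'.trans h2')
    nlinarith
  intro J
  set P := Literature.MathematicalPhysics.KineticTheory.HeatConduction.pinnedChain ω₂ lam β γ with hP_def
  -- the autocorrelation `c_N`
  set cN : ℝ → ℝ := fun t => ∫ z, J z * (∫ y, J y ∂(P.transitionKernel N T T t.toNNReal z)) ∂(P.gibbsMeasure N T)
    with hcN_def
  show |∫ t in Set.Ioi (0:ℝ), (1 - Real.exp (-(ν * t))) * cN t| ≤ ε * N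
  -- fixed-`N` integrability (LANDED, p144688)
  have hint : IntegrableOn cN (Ioi 0) :=
    Summit.AtomisticToContinuum.FouriersLaw.Theorems.AbelThermodynamicLimit.SeriesLawAtEveryLaplaceFrequency.stub_autocorrIntegrableOn
      ω₂ lam β γ hω hl hβ hγ T hT N
  -- the horizon
  set τ : ℝ := c₀ * N with hτ_def
  have hτ0 : 0 < τ := by positivity
  have hττ₀ : τ₀ ≤ τ := le_trans (le_max_left _ _) hτN
  have hττ₁ : τ₁ ≤ τ := le_trans (le_max_right _ _) hτN
  -- the windows
  set W : ℝ → ℝ := fun t => χ (t / τ) * (1 - Real.exp (-(ν * t))) with hW_def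
  set L : ℝ → ℝ := fun t => (1 - χ (t / τ)) * (1 - Real.exp (-(ν * t))) with hL_def
  have hw0 : ∀ t : ℝ, 0 < t → 0 ≤ 1 - Real.exp (-(ν * t)) := fun t ht => by
    have h : Real.exp (-(ν * t)) ≤ 1 := Real.exp_le_one_iff.2 (by nlinarith [mul_pos hν ht])
    linarith
  have hw1 : ∀ t : ℝ, 1 - Real.exp (-(ν * t)) ≤ 1 := fun t => by linarith [Real.exp_pos (-(ν * t))]
  have hWcont : Continuous W := (hχcont.comp (continuous_id.div_const τ)).mul (by fun_prop)
  have hLcont : Continuous L := (continuous_const.sub (hχcont.comp (continuous_id.div_const τ))).mul (by fun_prop)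
  have hWbd : ∀ t : ℝ, 0 < t → |W t| ≤ 1 := fun t ht => by
    simp only [hW_def]
    rw [abs_mul, abs_of_nonneg (hχI _).1, abs_of_nonneg (hw0 t ht)]
    exact mul_le_one₀ (hχI _).2 (hw0 t ht) (hw1 t)
  have hWzero : ∀ t : ℝ, τ ≤ t → W t = 0 := fun t ht => by
    have h' : 1 ≤ t / τ := by rwa [le_div_iff₀ hτ0, one_mul]
    simp only [hW_def, hχ_zero _ h', zero_mul]
  have hLzero : ∀ t : ℝ, t ≤ τ / 2 → L t = 0 := fun t ht => by
    have h' : t / τ ≤ 1 / 2 := by rw [div_le_iff₀ hτ0]; linarith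
    simp only [hL_def, hχ_one _ h', sub_self, zero_mul]
  have hLa : L (τ / 2) = 0 := hLzero _ le_rfl
  have hLnn : ∀ t : ℝ, 0 ≤ L t := fun t => by
    by_cases ht : t ≤ τ / 2
    · rw [hLzero t ht]
    · push Not at ht
      have ht0 : 0 < t := by linarith
      exact mul_nonneg (by linarith [(hχI (t / τ)).2]) (hw0 t ht0)
  have hLle : ∀ t : ℝ, L t ≤ 1 := fun t => by
    by_cases ht : t ≤ τ / 2
    · rw [hLzero t ht]; exact zero_le_one
    · push Not at ht
      have ht0 : 0 < t := by linarith
      exact mul_le_one₀ (by linarith [(hχI (t / τ)).1]) (hw0 t ht0) (hw1 t)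
  have hLmono : Monotone L := by
    intro t t' htt'
    by_cases ht : t ≤ τ / 2
    · rw [hLzero t ht]; exact hLnn t'
    · push Not at ht
      have ht0 : 0 < t := by linarith
      have ht'0 : 0 < t' := by linarith
      apply mul_le_mul
      · have : χ (t' / τ) ≤ χ (t / τ) := hχanti (div_le_div_of_nonneg_right htt' hτ0.le)
        linarith
      · have : Real.exp (-(ν * t')) ≤ Real.exp (-(ν * t)) := Real.exp_le_exp.2 (by nlinarith)
        linarith
      · exact hw0 t ht0
      · linarith [(hχI (t' / τ)).2]
  have hWL : ∀ t : ℝ, (1 - Real.exp (-(ν * t))) = W t + L t := fun t => by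
    simp only [hW_def, hL_def]; ring
  -- integrability of the weighted autocorrelation and the split `S_N = ∫ W c_N + ∫ L c_N`
  have hWint : IntegrableOn (fun t => W t * cN t) (Ioi 0) := by
    refine Integrable.bdd_mul hint hWcont.aestronglyMeasurable (c := 1) ?_
    exact (ae_restrict_iff' measurableSet_Ioi).2 (Eventually.of_forall fun t ht => by
      rw [Real.norm_eq_abs]; exact hWbd t ht)
  have hLint : IntegrableOn (fun t => L t * cN t) (Ioi 0) := by
    refine Integrable.bdd_mul hint hLcont.aestronglyMeasurable (c := 1) ?_
    exact Eventually.of_forall fun t => by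
      rw [Real.norm_eq_abs, abs_of_nonneg (hLnn t)]; exact hLle t
  have hsplit : ∫ t in Ioi (0:ℝ), (1 - Real.exp (-(ν * t))) * cN t =
      (∫ t in Ioi (0:ℝ), W t * cN t) + ∫ t in Ioi (0:ℝ), L t * cN t := by
    have hpt : ∀ t, (1 - Real.exp (-(ν * t))) * cN t = W t * cN t + L t * cN t := fun t => by
      rw [hWL t]; ring
    simp_rw [hpt]
    exact integral_add hWint hLint
  -- LATE WINDOW: Bonnet (landed P2 of 13416's line) + post-crossing tails (stub K1)
  have hlate : |∫ t in Ioi (0:ℝ), L t * cN t| ≤ ε / 8 * N := by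
    have hτ2 : (0:ℝ) ≤ τ / 2 := by positivity
    have heq : ∫ t in Ioi (0:ℝ), L t * cN t = ∫ t in Ioi (τ / 2), L t * cN t := by
      rw [← Ioc_union_Ioi_eq_Ioi hτ2, setIntegral_union (Ioc_disjoint_Ioi le_rfl) measurableSet_Ioi
        (hLint.mono_set Ioc_subset_Ioi_self) (hLint.mono_set (Ioi_subset_Ioi hτ2))]
      rw [setIntegral_eq_zero_of_forall_eq_zero (fun t ht => by rw [hLzero t ht.2, zero_mul]), zero_add]
    rw [heq]
    refine Summit.AtomisticToContinuum.FouriersLaw.Theorems.UniformAbelianRegularity.ZeroMeanDyadicSplice.stub_monotoneWindow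
      cN L (τ / 2) (ε / 8 * N) (hint.mono_set (Ioi_subset_Ioi hτ2)) hLmono hLcont hLa hLle ?_
    intro ξ hξ
    have hξ' : c₀ / 2 * N ≤ ξ := by
      have : c₀ / 2 * N = τ / 2 := by simp only [hτ_def]; ring
      linarith
    exact hN₃ N hN₃N ξ hξ'
  -- EARLY WINDOW: splice (stub) + the early bulk window lemma (Riesz/Abel)
  have hCint : IntegrableOn C (Ioc 0 τ) := integrableOn_Ioc_of_bounded hCm hM 0 τ
  have hEint' : IntegrableOn E (Ioc 0 τ) := hEint τ hτ0
  have hcNint' : IntegrableOn cN (Ioc 0 τ) := hint.mono_set Ioc_subset_Ioi_self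
  set R : ℝ → ℝ := fun t => cN t - ((N:ℝ) - 1) * C t - E t with hR_def
  have hRint : IntegrableOn R (Ioc 0 τ) := (hcNint'.sub (hCint.const_mul _)).sub hEint'
  have hmatch' : ∫ t in Ioc (0:ℝ) τ, |R t| ≤ K := hmatch N hN₁N
  have hWbd' : ∀ᵐ t ∂(volume.restrict (Ioc (0:ℝ) τ)), ‖W t‖ ≤ 1 :=
    (ae_restrict_iff' measurableSet_Ioc).2 (Eventually.of_forall fun t ht => by
      rw [Real.norm_eq_abs]; exact hWbd t ht.1)
  have hWC : IntegrableOn (fun t => W t * C t) (Ioc 0 τ) := Integrable.bdd_mul hCint hWcont.aestronglyMeasurable hWbd'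
  have hWE : IntegrableOn (fun t => W t * E t) (Ioc 0 τ) := Integrable.bdd_mul hEint' hWcont.aestronglyMeasurable hWbd'
  have hWR : IntegrableOn (fun t => W t * R t) (Ioc 0 τ) := Integrable.bdd_mul hRint hWcont.aestronglyMeasurable hWbd'
  have hearly_eq : ∫ t in Ioi (0:ℝ), W t * cN t = ∫ t in Ioc (0:ℝ) τ, W t * cN t := by
    rw [← Ioc_union_Ioi_eq_Ioi hτ0.le, setIntegral_union (Ioc_disjoint_Ioi le_rfl) measurableSet_Ioi
      (hWint.mono_set Ioc_subset_Ioi_self) (hWint.mono_set (Ioi_subset_Ioi hτ0.le))]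
    rw [setIntegral_eq_zero_of_forall_eq_zero (t := Ioi τ)
      (fun t ht => by rw [hWzero t (le_of_lt ht), zero_mul]), add_zero]
  have hdecomp : ∫ t in Ioc (0:ℝ) τ, W t * cN t =
      ((N:ℝ) - 1) * (∫ t in Ioc (0:ℝ) τ, W t * C t) + (∫ t in Ioc (0:ℝ) τ, W t * E t) +
        ∫ t in Ioc (0:ℝ) τ, W t * R t := by
    have hpt : ∀ t, W t * cN t = ((N:ℝ) - 1) * (W t * C t) + W t * E t + W t * R t := fun t => by
      simp only [hR_def]; ring
    have i1 : Integrable (fun t => ((N:ℝ) - 1) * (W t * C t)) (volume.restrict (Ioc (0:ℝ) τ)) := hWC.const_mul _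
    have i12 : Integrable (fun t => ((N:ℝ) - 1) * (W t * C t) + W t * E t) (volume.restrict (Ioc (0:ℝ) τ)) :=
      i1.add hWE
    simp_rw [hpt]
    rw [integral_add i12 hWR, integral_add i1 hWE, integral_const_mul]
  have hE_bd : |∫ t in Ioc (0:ℝ) τ, W t * E t| ≤ ε / 8 * N := by
    calc |∫ t in Ioc (0:ℝ) τ, W t * E t| ≤ ∫ t in Ioc (0:ℝ) τ, |W t * E t| := abs_integral_le_integral_abs
      _ ≤ ∫ t in Ioc (0:ℝ) τ, |E t| :=
          setIntegral_mono_on hWE.abs hEint'.abs measurableSet_Ioc (fun t ht => by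
            rw [abs_mul]; exact mul_le_of_le_one_left (abs_nonneg _) (hWbd t ht.1))
      _ ≤ ε / (8 * c₀) * τ := hCes' τ hττ₀
      _ = ε / 8 * N := by simp only [hτ_def]; field_simp
  have hR_bd : |∫ t in Ioc (0:ℝ) τ, W t * R t| ≤ ε / 8 * N := by
    calc |∫ t in Ioc (0:ℝ) τ, W t * R t| ≤ ∫ t in Ioc (0:ℝ) τ, |W t * R t| := abs_integral_le_integral_abs
      _ ≤ ∫ t in Ioc (0:ℝ) τ, |R t| :=
          setIntegral_mono_on hWR.abs hRint.abs measurableSet_Ioc (fun t ht => by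
            rw [abs_mul]; exact mul_le_of_le_one_left (abs_nonneg _) (hWbd t ht.1))
      _ ≤ K := hmatch'
      _ ≤ ε / 8 * N := hKN
  have hC_bd : |∫ t in Ioc (0:ℝ) τ, W t * C t| ≤ ε / 8 := hC_bd' τ hττ₁
  have hearly : |∫ t in Ioi (0:ℝ), W t * cN t| ≤ ((N:ℝ) - 1) * (ε / 8) + ε / 8 * N + ε / 8 * N := by
    rw [hearly_eq, hdecomp]
    have hN1' : (0:ℝ) ≤ (N:ℝ) - 1 := by linarith
    calc |((N:ℝ) - 1) * (∫ t in Ioc (0:ℝ) τ, W t * C t) + (∫ t in Ioc (0:ℝ) τ, W t * E t) +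
            ∫ t in Ioc (0:ℝ) τ, W t * R t|
        ≤ |((N:ℝ) - 1) * ∫ t in Ioc (0:ℝ) τ, W t * C t| + |∫ t in Ioc (0:ℝ) τ, W t * E t| +
            |∫ t in Ioc (0:ℝ) τ, W t * R t| := abs_add_three _ _ _
      _ = ((N:ℝ) - 1) * |∫ t in Ioc (0:ℝ) τ, W t * C t| + |∫ t in Ioc (0:ℝ) τ, W t * E t| +
            |∫ t in Ioc (0:ℝ) τ, W t * R t| := by rw [abs_mul, abs_of_nonneg hN1']
      _ ≤ ((N:ℝ) - 1) * (ε / 8) + ε / 8 * N + ε / 8 * N := by gcongr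
  -- assemble
  rw [hsplit]
  calc |(∫ t in Ioi (0:ℝ), W t * cN t) + ∫ t in Ioi (0:ℝ), L t * cN t|
      ≤ |∫ t in Ioi (0:ℝ), W t * cN t| + |∫ t in Ioi (0:ℝ), L t * cN t| := abs_add_le _ _
    _ ≤ (((N:ℝ) - 1) * (ε / 8) + ε / 8 * N + ε / 8 * N) + ε / 8 * N := add_le_add hearly hlate
    _ ≤ ε * N := by nlinarith

/-- **Registered glue stub `stub_regularityOfAbelSummableSpliceAndTails` — (R) ⇐ Abel-summable positive-type splice ∧ post-crossing tails** (concludes the `EmbeddedDrudeMourre` copy of the crux, `rfl`-equal to the `StaticAbelianSqueeze` one): the bulk enters only through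
`|C| ≤ M`, positive type, and CONVERGENT ABEL MEANS; the Riesz half is the landed Karamata lemma `stub_karamataRieszTwo` (p87844). -/
theorem stub_regularityOfAbelSummableSpliceAndTails :
    (∀ ω₂ lam β γ : ℝ, 0 < ω₂ → 0 < lam → 0 < β → 0 < γ → ∀ T : ℝ, 0 < T →
      ∃ (C E : ℝ → ℝ) (M Λ c₀ K : ℝ) (N₁ : ℕ),
        0 < c₀ ∧ 0 ≤ K ∧ Measurable C ∧ Measurable E ∧ (∀ t : ℝ, |C t| ≤ M) ∧
        (∀ t : ℝ, 0 ≤ t → 0 ≤ ∫ u in Set.Ioc (0:ℝ) t, (t - u) * C u) ∧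
        Filter.Tendsto (fun ν : ℝ => ∫ t in Set.Ioi (0:ℝ), Real.exp (-(ν * t)) * C t) (nhdsWithin (0:ℝ) (Set.Ioi 0)) (nhds Λ) ∧
        (∀ τ : ℝ, 0 < τ → MeasureTheory.IntegrableOn E (Set.Ioc 0 τ)) ∧
        (∀ ε : ℝ, 0 < ε → ∃ τ₀ : ℝ, 0 < τ₀ ∧ ∀ τ : ℝ, τ₀ ≤ τ → ∫ t in Set.Ioc 0 τ, |E t| ≤ ε * τ) ∧
        (∀ N : ℕ, N₁ ≤ N → let J : Literature.MathematicalPhysics.KineticTheory.HeatConduction.PhaseSpace N → ℝ := fun z => ∑ i : Fin N, (Literature.MathematicalPhysics.KineticTheory.HeatConduction.pinnedChain ω₂ lam β γ).bondCurrent N i z; ∫ t in Set.Ioc 0 (c₀ * N), |(∫ z, J z * (∫ y, J y ∂((Literature.MathematicalPhysics.KineticTheory.HeatConduction.pinnedChain ω₂ lam β γ).transitionKernel N T T t.toNNReal z)) ∂((Literature.MathematicalPhysics.KineticTheory.HeatConduction.pinnedChain ω₂ lam β γ).gibbsMeasure N T)) - ((N:ℝ) - 1) * C t - E t| ≤ K))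 →
    (∀ ω₂ lam β γ : ℝ, 0 < ω₂ → 0 < lam → 0 < β → 0 < γ → ∀ T : ℝ, 0 < T → ∀ c₀ : ℝ, 0 < c₀ → ∀ ε : ℝ, 0 < ε →
      ∃ N₀ : ℕ, ∀ N : ℕ, N₀ ≤ N → ∀ ξ : ℝ, c₀ * N ≤ ξ → let J : Literature.MathematicalPhysics.KineticTheory.HeatConduction.PhaseSpace N → ℝ := fun z => ∑ i : Fin N, (Literature.MathematicalPhysics.KineticTheory.HeatConduction.pinnedChain ω₂ lam β γ).bondCurrent N i z; |∫ s in Set.Ioi ξ, ∫ z, J z * (∫ y, J y ∂((Literature.MathematicalPhysics.KineticTheory.HeatConduction.pinnedChain ω₂ lam β γ).transitionKernel N T T s.toNNReal z)) ∂((Literature.MathematicalPhysics.KineticTheory.HeatConduction.pinnedChain ω₂ lam β γ).gibbsMeasure N T)| ≤ ε * N) →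
    _root_.Summit.AtomisticToContinuum.FouriersLaw.Theses.EmbeddedDrudeMourre.UniformAbelianRegularity := by
  intro h1 h3
  refine uniformAbelianRegularity_of_rieszSummableSplice_and_tails (fun ω₂ lam β γ hω hl hβ hγ T hT => ?_) h3
  obtain ⟨C, E, M, Λ, c₀, K, N₁, hc₀, hK, hCm, hEm, hM, hV, hAb, hEint, hCes, hmatch⟩ := h1 ω₂ lam β γ hω hl hβ hγ T hT
  exact ⟨C, E, M, Λ, c₀, K, N₁, hc₀, hK, hCm, hEm, hM,
    Summit.AtomisticToContinuum.FouriersLaw.Theorems.AbelThermodynamicLimit.LoomisCompactHorizonWitness.stub_karamataRieszTwo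
      C Λ M hCm hM hV hAb, hAb, hEint, hCes, hmatch⟩

end Summit.AtomisticToContinuum.FouriersLaw.Theorems.UniformAbelianRegularity.AbelSummableSplice

end
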